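/-
Copyright (c) 2026 the pub-hodgecm-mathlib formalisation cell (harness21).  Prover seat hodgecm-mathlib-K2Liu-p07 (g3), Track B «K2-LIT»,
#184♮ = hLiu418 = `stmt-HodgeConjecture-24832`; #42S payer road, organ S1 (local Siegel–Weil spanning), ROAD W, (R-b)∕(R-c) junction: the doubled rational
frame `Θ⁻¹ = frameConj P_D` (K2E5-p17 (g7) ★ (R-b) FILE 1 `K2LiuLocalSWTensorBlockFrame`) COMMUTES with the similitude transport `Ad(d_a)` (★ F5′-A1).
-/
import Summits.HodgeConjecture.HodgeConjecture.Theorems.K2LiuLocalSWTensorBlockFrame        -- ★ (R-b) FILE 1 K2E5-p17: `frameConj` frame letters, `blk_matA_frameConj`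
import Summits.HodgeConjecture.HodgeConjecture.Theorems.K2LiuLocalSWRamifiedRelativeSign    -- ★ F7r-1 §3 (+ ★ A1): `blk?_matA_localCongr_dA`
import HarnessLib

/-!
# Crux `HLiu418`, #42S organ S1, ROAD W, (R-b)∕(R-c) junction: `P_D (Ad_{d_a} h) P_D⁻¹ = Ad_{d_a} (P_D h P_D⁻¹)` — THE DOUBLED FRAME COMMUTES WITH `Ad(d_a)`

Cell `hodgecm-mathlib`, crux item hLiu418 = `stmt-HodgeConjecture-24832`; squad K2 ∕ K2Liu; LEAD F0P6-plan (g14), organ lead K2Liu-p06 (g4);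
prover K2Liu-p07 (g3).  THEOREMS ONLY (no `def`, no instance, no notation, no named-fact hypothesis, no `sorry`); lane
`--supports stmt-HodgeConjecture-24832 --as helper`.

WHY.  The dilation invariance (d) of the ramified witness (★ F7r-4∕F7r-5) is read in the BLOCK datum through K2E5-p17's frame `Θ = (frameConj P_D)⁻¹` ((R-b)), while
`Ad(d_a)` is the similitude transport of ★ F5′ (`localCongr E c DA …`, `D_A = reindex e₂ (cayR · diag(1, a·1) · cayRinv)`, the SAME matrix for every Gram datum of
rank `n + n`).  This file proves the two commute: on adapted blocks `frameConj P_D` conjugates every block by `P_v` (★ `blk_matA_frameConj`) and `Ad(d_a)` rescales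
`B ↦ a⁻¹B`, `C ↦ aC` (★ `blkA∕blkB∕blkC∕blkD_matA_localCongr_dA`); scalars commute with `P_v`.
* `eq_of_blk_matA_eq` — an element of `U(𝔻)(F_v)` is determined by its four adapted blocks;
* **`frameConj_localCongr_dA`** — `frameConj P_D (Ad_{d_a} h) = Ad_{d_a} (frameConj P_D h)`.
References: [PlatonovRapinchuk1994] §2.3; [Kudla1994] §3; [HarrisKudlaSweet1996] §1 (1.9).
HONEST LABEL.  Count-neutral helper: `HC_CM` is proved only modulo the 7 printed citations (2 remaining named inputs: hLiu418 = `stmt-HodgeConjecture-24832`,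
h413 = `stmt-HodgeConjecture-24833`) until rung 0 closes.
-/

set_option autoImplicit false
set_option linter.dupNamespace false -- the mandated namespace repeats `HodgeConjecture.HodgeConjecture`

noncomputable section

open scoped Matrix
open NumberField IsDedekindDomain Matrix
open Literature.NumberTheory.Automorphic Literature.NumberTheory.Automorphic.UnitaryGroup
open Literature.NumberTheory.GelbartRogawski1991 Literature.NumberTheory.GelbartRogawski1991.AdaptedBlocks
open Literature.NumberTheory.GelbartRogawski1991.UnitaryDualPair.LocalSplitting
open Literature.NumberTheory.GelbartRogawski1991.UnitaryDualPair.LocalSplitting.FrameTransport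
open Summit.HodgeConjecture.HodgeConjecture.Cruxes.HLiu418.K2LiuLocalSWSimilitudeAlgebra
open Summit.HodgeConjecture.HodgeConjecture.Cruxes.HLiu418.K2LiuLocalSWRamifiedRelativeSign
open Summit.HodgeConjecture.HodgeConjecture.Cruxes.HLiu418.K2LiuLocalSWTensorBlockFrame

namespace Summit.HodgeConjecture.HodgeConjecture.Cruxes.HLiu418.K2LiuFrameConjSimilitude

variable (F : Type) [Field F] [NumberField F] (E : Type) [Field E] [NumberField E] [Algebra F E] [Algebra.IsQuadraticExtension F E]
  (c : E ≃ₐ[F] E) (v : HeightOneSpectrum (𝓞 F)) (n : ℕ) {T₀ T₀' : Matrix (Fin n) (Fin n) F}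
  {JD : Matrix (Fin (n + n)) (Fin (n + n)) E} (hJD : JD = (gramD F n T₀).map (algebraMap F E))
  {JD' : Matrix (Fin (n + n)) (Fin (n + n)) E} (hJD' : JD' = (gramD F n T₀').map (algebraMap F E))

omit [Algebra.IsQuadraticExtension F E] in
/-- an element of `U(𝔻)(F_v)` is determined by its four adapted blocks (`adapt M = [[A, B], [C, D]]`, `adapt` a fixed conjugation, ★ `matA_injective`). [cite: Kudla1994, §3] -/
theorem eq_of_blk_matA_eq (g g' : UnitaryGroup.localPi E c (n + n) JD v)
    (hA : blkA (matA F E c v n g) = blkA (matA F E c v n g')) (hB : blkB (matA F E c v n g) = blkB (matA F E c v n g'))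
    (hC : blkC (matA F E c v n g) = blkC (matA F E c v n g')) (hD : blkD (matA F E c v n g) = blkD (matA F E c v n g')) : g = g' := by
  apply matA_injective F E c v n
  have h : adapt (matA F E c v n g) = adapt (matA F E c v n g') := by rw [adapt_eq, adapt_eq, hA, hB, hC, hD]
  calc matA F E c v n g = cayR _ _ * adapt (matA F E c v n g) * cayRinv _ _ := by
        rw [adapt, ← Matrix.mul_assoc, ← Matrix.mul_assoc, cayR_mul_cayRinv, Matrix.one_mul, Matrix.mul_assoc, cayR_mul_cayRinv, Matrix.mul_one]
    _ = cayR _ _ * adapt (matA F E c v n g') * cayRinv _ _ := by rw [h]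
    _ = matA F E c v n g' := by
        rw [adapt, ← Matrix.mul_assoc, ← Matrix.mul_assoc, cayR_mul_cayRinv, Matrix.one_mul, Matrix.mul_assoc, cayR_mul_cayRinv, Matrix.mul_one]

variable (P : GL (Fin n) F) (hP : ((P : Matrix (Fin n) (Fin n) F))ᵀ * T₀ * (P : Matrix (Fin n) (Fin n) F) = T₀')
  {PD : GL (Fin (n + n)) F} (hPD : PD = UnitaryGroup.reindexGL (e₂ n) (UnitaryGroup.blockDiagGL (P, P)))
  (a : Fˣ) {D₀ : GL (Fin (n + n)) F}
  (hD₀ : (D₀ : Matrix (Fin (n + n)) (Fin (n + n)) F) =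
    Matrix.reindex (e₂ n) (e₂ n) (cayR F (Fin n) * Matrix.fromBlocks 1 0 0 ((a : F) • (1 : Matrix (Fin n) (Fin n) F)) * cayRinv F (Fin n)))
  {DA : GL (Fin (n + n)) E} (hDA : DA = Matrix.GeneralLinearGroup.map (algebraMap F E) D₀)
  {b : E} (hb : b ≠ 0) (hDAJ : formCongr (c : E →+* E) DA (b • JD) = JD) (hDAJ' : formCongr (c : E →+* E) DA (b • JD') = JD')

omit [Algebra.IsQuadraticExtension F E] in
include hD₀ hDA hPD in
/-- **THE DOUBLED FRAME COMMUTES WITH `Ad(d_a)`**: `frameConj P_D (Ad_{d_a} h) = Ad_{d_a} (frameConj P_D h)` — on adapted blocks, `frameConj P_D` conjugates each block by `P_v`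
(★ `blk_matA_frameConj`) and `Ad(d_a)` rescales `B ↦ a⁻¹B`, `C ↦ aC`; scalars commute with `P_v`. [cite: PlatonovRapinchuk1994, §2.3] [cite: Kudla1994, §3]
[cite: HarrisKudlaSweet1996, §1 (1.9)] -/
theorem frameConj_localCongr_dA (h : UnitaryGroup.localPi E c (n + n) JD' v) :
    frameConj F E c v (n + n) hJD hJD' PD (transpose_pd_mul_gramD_mul_pd F n P hP hPD) (localCongr E c DA hb hDAJ' v h) =
      localCongr E c DA hb hDAJ v (frameConj F E c v (n + n) hJD hJD' PD (transpose_pd_mul_gramD_mul_pd F n P hP hPD) h) := by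
  obtain ⟨hA₁, hB₁, hC₁, hD₁⟩ := blk_matA_frameConj F E c v n hJD hJD' P hP hPD (localCongr E c DA hb hDAJ' v h)
  obtain ⟨hA₂, hB₂, hC₂, hD₂⟩ := blk_matA_frameConj F E c v n hJD hJD' P hP hPD h
  apply eq_of_blk_matA_eq F E c v n
  · rw [hA₁, blkA_matA_localCongr_dA F E c v n a hD₀ hDA hb hDAJ', blkA_matA_localCongr_dA F E c v n a hD₀ hDA hb hDAJ, hA₂]
  · rw [hB₁, blkB_matA_localCongr_dA F E c v n a hD₀ hDA hb hDAJ', blkB_matA_localCongr_dA F E c v n a hD₀ hDA hb hDAJ, hB₂, Matrix.mul_smul,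
      Matrix.smul_mul]
  · rw [hC₁, blkC_matA_localCongr_dA F E c v n a hD₀ hDA hb hDAJ', blkC_matA_localCongr_dA F E c v n a hD₀ hDA hb hDAJ, hC₂, Matrix.mul_smul,
      Matrix.smul_mul]
  · rw [hD₁, blkD_matA_localCongr_dA F E c v n a hD₀ hDA hb hDAJ', blkD_matA_localCongr_dA F E c v n a hD₀ hDA hb hDAJ, hD₂]

end Summit.HodgeConjecture.HodgeConjecture.Cruxes.HLiu418.K2LiuFrameConjSimilitude
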